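import Literature.NumberTheory.EllipticCurves.HeckeOperatorsProofs

/-!
# Commutativity of the Hecke algebra of `S_k(Γ₀(N))` (trunk EllArithM, item C5)

D-0014 keeps `Literature/` sorry-free by stating cited results as named facts `def X : Prop`.
This file discharges the fact `heckeAlgebra_commutative_gamma0` of
`Literature.NumberTheory.EllipticCurves.HeckeOperators` (the `ℂ`-algebra generated by the `T_p`,
`p` prime, acting on `S_k(Γ₀(N))` is **commutative**) as
`theorem heckeAlgebra_commutative_gamma0_holds : heckeAlgebra_commutative_gamma0 N k`; users
holding `(h : heckeAlgebra_commutative_gamma0 N k)` are fed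
`heckeAlgebra_commutative_gamma0_holds N k`.

It sits on top of `HeckeOperatorsProofs`, which already provides the double coset formula
(`heckeCorrespondence_apply_eq_sum_slash_holds`, Diamond–Shurman Lemma 5.1.2 / Def. 5.1.3) and
Diamond–Shurman Prop. 5.2.1 for `Γ₀(N)` (`coe_heckeT_gamma0_eq_sum`:
`T_p f = ∑_{j mod p} f ∣[k] (1 j; 0 p) + 𝟙_{p ∤ N} f ∣[k] diag(p, 1)`, with the matrices
`tpG p = diag(1, p)`, `tpB p j = (1 j; 0 p)`, `tpD p = diag(p, 1)` of `GL(2, ℝ)`); neither is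
re-derived here (`tpG_eq_intGL`, `intGL_heckeRep_some`, `intGL_heckeRep_none` identify the integer
matrices of this file with `tpG`, `tpB`, `tpD`, and `coe_heckeT_gamma0` is `coe_heckeT_gamma0_eq_sum`
re-indexed by `HeckeIdx N p`).

## Source and proof architecture

Diamond–Shurman, *A first course in modular forms* (GTM 228), §5.1–5.3. The book proves
`T_p T_q = T_q T_p` on `M_k(Γ₁(N))` (Prop. 5.2.4(c)) through the Fourier-coefficient
formula (5.4); §5.3: "the `T_n` all commute by Proposition 5.2.4", and
`S_k(Γ₀(N)) = S_k(N, 𝟙)`. We give the elementary *double coset* proof of the same statement on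
`S_k(Γ₀(N))`, built from the ingredients of §5.1–5.2 (it does not use `q`-expansions):

1. `sum_slash_eq_sum_slash_of_transversal`: for `Γ`-invariant `f`, `∑ᵢ f ∣[k] αᵢ` is the same
   for any two exact transversals `(αᵢ)` of `Γ \ S` (§5.1, after Def. 5.1.3: the double coset
   operator "is independent of how the `βⱼ` are chosen (Exercise 5.1.3)").
2. `Delta0 N n = Δ₀ᴺ(n) := {M ∈ M₂(ℤ) : det M = n, N ∣ c, gcd(a, N) = 1}` ((3.16) and
   Exercise 3.8.8(b) for `n = p`) and the representatives `heckeRep`: `βⱼ = (1 j; 0 p)`,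
   `j ∈ ℤ/pℤ`, and `β_∞ = diag(p, 1)` when `p ∤ N` ((5.2) and Exercise 5.2.4; after
   Prop. 5.2.1: for `Γ₀(N)` "the last representative can be replaced by `β_∞ = (p 0; 0 1)`").
   `existsUnique_mem_delta0_mul_heckeRep`: for `p` prime and `p ∤ D`, every `M ∈ Δ₀ᴺ(pD)` is
   `M' βᵢ`, `M' ∈ Δ₀ᴺ(D)`, for exactly one index `i` (§5.2 before (5.2): `p ∤ a` gives
   `j = b a⁻¹ (mod p)`; `p ∣ a` is caught by `β_∞`; the case `D = 1` is the decomposition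
   `Γ₀(N) diag(1,p) Γ₀(N) = ⊔ᵢ Γ₀(N) βᵢ` of Prop. 5.2.1 / Exercise 5.2.4, which the tree has as
   `existsUnique_fin` / `existsUnique_option` in `HeckeOperatorsProofs`).
3. `coe_heckeT_gamma0`: `T_p f = ∑_{i ∈ I_p(N)} f ∣[k] βᵢ` on `S_k(Γ₀(N))` — this is
   `coe_heckeT_gamma0_eq_sum` (Prop. 5.2.1 for `Γ₀(N)`, proved in `HeckeOperatorsProofs`)
   re-indexed, the integer matrices being sent to `GL(2, ℝ)` by `intGL`.
4. `coe_heckeT_mul_heckeT_gamma0`: `T_p T_q f = ∑ᵢ ∑ⱼ f ∣[k] (β^q_j β^p_i)`, and for `p ≠ q` the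
   products `β^q_j β^p_i` form an exact transversal of `Γ₀(N) \ Δ₀ᴺ(pq)` (step 2 with `D = q`,
   then `D = 1`); this is symmetric in `p, q`, so step 1 gives `heckeT_comm_gamma0_of_prime`
   (the case `p, q` prime of the fact `heckeT_comm_gamma0` of `HeckeOperators`), and the algebra
   generated by pairwise commuting elements is commutative
   (`heckeAlgebra_commutative_gamma0_holds`).

## References

* F. Diamond, J. Shurman, *A first course in modular forms*, GTM 228, Springer 2005, §3.8
  ((3.16), Exercise 3.8.8(b)), §5.1 (Lemma 5.1.2, Def. 5.1.3, Exercise 5.1.3), §5.2 ((5.2),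
  Prop. 5.2.1, Exercises 5.2.2–5.2.4, Prop. 5.2.4), §5.3 ((5.10)–(5.11)).
  doi:10.1007/978-0-387-27226-9
-/

noncomputable section

open scoped MatrixGroups ModularForm

open ConjAct Pointwise UpperHalfPlane CongruenceSubgroup Matrix.SpecialLinearGroup

namespace Literature.NumberTheory.EllipticCurves.ModularForms

/-! ### Sums over transversals -/

/-- **Independence of the transversal.** Let `f` be `Γ`-invariant of weight `k` and let
`α : ι → GL(2, ℝ)`, `β : ι' → GL(2, ℝ)` be two exact transversals of `Γ \ S` for the same set
`S` (every `αᵢ, βⱼ` lies in `S`, and every `x ∈ S` lies in exactly one right coset `Γ αᵢ` and in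
exactly one `Γ βⱼ`). Then `∑ᵢ f ∣[k] αᵢ = ∑ⱼ f ∣[k] βⱼ`: the bijection `i ↦ j(i)` with
`Γ αᵢ = Γ βⱼ₍ᵢ₎` matches the terms since `f ∣[k] (γ β) = f ∣[k] β` for `γ ∈ Γ`
(Diamond–Shurman §5.1, after Def. 5.1.3: the double coset operator "is independent of how the
`βⱼ` are chosen (Exercise 5.1.3)"). [cite: DiamondShurman2005, §5.1 Def. 5.1.3 and Exercise 5.1.3] -/
theorem sum_slash_eq_sum_slash_of_transversal {Γ : Subgroup (GL (Fin 2) ℝ)} {k : ℤ}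
    {f : ℍ → ℂ} (hf : ∀ γ ∈ Γ, f ∣[k] γ = f) (S : Set (GL (Fin 2) ℝ)) {ι ι' : Type*}
    [Fintype ι] [Fintype ι'] {α : ι → GL (Fin 2) ℝ} {β : ι' → GL (Fin 2) ℝ}
    (hα : ∀ i, α i ∈ S) (hα' : ∀ x ∈ S, ∃! i, x * (α i)⁻¹ ∈ Γ) (hβ : ∀ j, β j ∈ S)
    (hβ' : ∀ x ∈ S, ∃! j, x * (β j)⁻¹ ∈ Γ) :
    ∑ i, f ∣[k] α i = ∑ j, f ∣[k] β j := by
  choose σ hσ using fun i ↦ (hβ' (α i) (hα i)).exists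
  choose τ hτ using fun j ↦ (hα' (β j) (hβ j)).exists
  have hτσ : ∀ i, τ (σ i) = i := fun i ↦
    (hα' _ (hβ (σ i))).unique (hτ (σ i)) (by simpa using Γ.inv_mem (hσ i))
  have hστ : ∀ j, σ (τ j) = j := fun j ↦
    (hβ' _ (hα (τ j))).unique (hσ (τ j)) (by simpa using Γ.inv_mem (hτ j))
  refine Fintype.sum_equiv ⟨σ, τ, hτσ, hστ⟩ _ _ fun i ↦ ?_
  calc f ∣[k] α i = f ∣[k] ((α i * (β (σ i))⁻¹) * β (σ i)) := by rw [inv_mul_cancel_right]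
    _ = f ∣[k] β (σ i) := by rw [SlashAction.slash_mul, hf _ (hσ i)]

/-! ### The sets `Δ₀ᴺ(n)` and the coset representatives `βⱼ`, `β_∞` -/

/-- The set `Δ₀ᴺ(n)` of integer matrices `(a b; c d)` with `det = n`, `c ≡ 0 (mod N)` and
`gcd(a, N) = 1`. For `n = p` prime this is the double coset `Γ₀(N) diag(1, p) Γ₀(N)`
(Diamond–Shurman (3.16) and Exercise 3.8.8(b): "describe the double coset
`Γ₀(N) diag(1, p) Γ₀(N)` as a subset of `M₂(ℤ)`"; cf. the semigroup `Δ₀'(N)` of Shimura 1971,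
Ch. 3). `Δ₀ᴺ(1) = Γ₀(N)` and `Δ₀ᴺ(m) Δ₀ᴺ(n) ⊆ Δ₀ᴺ(mn)`. [cite: DiamondShurman2005, §3.8 (3.16) and Exercise 3.8.8(b)] -/
def Delta0 (N : ℕ) (n : ℤ) : Set (Matrix (Fin 2) (Fin 2) ℤ) :=
  {M | M.det = n ∧ (N : ℤ) ∣ M 1 0 ∧ IsCoprime (M 0 0) N}

/-- `Δ₀ᴺ(m) · Δ₀ᴺ(n) ⊆ Δ₀ᴺ(m n)`: these matrices form a multiplicative semigroup. [folklore] -/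
lemma mul_mem_delta0 {N : ℕ} {m n : ℤ} {A B : Matrix (Fin 2) (Fin 2) ℤ} (hA : A ∈ Delta0 N m)
    (hB : B ∈ Delta0 N n) : A * B ∈ Delta0 N (m * n) := by
  obtain ⟨hAd, ⟨a', ha'⟩, hAc⟩ := hA
  obtain ⟨hBd, ⟨b', hb'⟩, hBc⟩ := hB
  refine ⟨by rw [Matrix.det_mul, hAd, hBd], ⟨a' * B 0 0 + A 1 1 * b', ?_⟩, ?_⟩
  · simp only [Matrix.mul_apply, Fin.sum_univ_two, ha', hb']
    ring
  · -- `A₀₀ B₀₀ + A₀₁ (N b')` is coprime to `N`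
    have h00 : (A * B) 0 0 = A 0 0 * B 0 0 + A 0 1 * b' * N := by
      simp only [Matrix.mul_apply, Fin.sum_univ_two, hb']
      ring
    rw [h00]
    exact (hAc.mul_left hBc).add_mul_right_left _

/-- The elements of `Δ₀ᴺ(1)` are exactly the matrices of `Γ₀(N)`. [folklore] -/
lemma exists_mem_delta0_one_iff {N : ℕ} (P : Matrix (Fin 2) (Fin 2) ℤ → Prop) :
    (∃ M ∈ Delta0 N 1, P M) ↔ ∃ γ : SL(2, ℤ), γ ∈ Gamma0 N ∧ P γ := by
  constructor
  · rintro ⟨M, ⟨hd, hc, -⟩, hP⟩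
    refine ⟨⟨M, hd⟩, ?_, hP⟩
    simpa [Gamma0_mem, ZMod.intCast_zmod_eq_zero_iff_dvd] using hc
  · rintro ⟨γ, hγ, hP⟩
    have hc : (N : ℤ) ∣ (γ : Matrix (Fin 2) (Fin 2) ℤ) 1 0 := by
      simpa [Gamma0_mem, ZMod.intCast_zmod_eq_zero_iff_dvd] using hγ
    refine ⟨γ, ⟨γ.det_coe, hc, ?_⟩, hP⟩
    obtain ⟨c', hc'⟩ := hc
    have hdet := γ.det_coe
    rw [Matrix.det_fin_two] at hdet
    exact ⟨(γ : Matrix (Fin 2) (Fin 2) ℤ) 1 1, -((γ : Matrix (Fin 2) (Fin 2) ℤ) 0 1 * c'),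
      by linear_combination hdet + (γ : Matrix (Fin 2) (Fin 2) ℤ) 0 1 * hc'⟩

/-- Right cancellation of an integer matrix with nonzero determinant. [folklore] -/
lemma matrix_mul_right_cancel_of_det_ne_zero {X Y B : Matrix (Fin 2) (Fin 2) ℤ}
    (hB : B.det ≠ 0) (h : X * B = Y * B) : X = Y := by
  have h2 := congrArg (· * B.adjugate) h
  simp only [Matrix.mul_assoc, Matrix.mul_adjugate, Matrix.mul_smul, Matrix.mul_one] at h2
  exact smul_right_injective _ hB h2

/-- The coset representatives of `Γ₀(N) \ Γ₀(N) diag(1, p) Γ₀(N)` (Diamond–Shurman (5.2),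
Prop. 5.2.1 and Exercise 5.2.4): `β_j = (1 j; 0 p)` for `j ∈ ℤ/pℤ` (lifted to `0 ≤ j < p`),
indexed by `some j`, and `β_∞ = diag(p, 1)`, indexed by `none` (only used when `p ∤ N`; for
`Γ₀(N)` "the last representative can be replaced by `β_∞ = (p 0; 0 1)`", after Prop. 5.2.1).
[cite: DiamondShurman2005, §5.2 (5.2) and Exercise 5.2.4] -/
def heckeRep (p : ℕ) : Option (ZMod p) → Matrix (Fin 2) (Fin 2) ℤ
  | some j => !![1, (j.val : ℤ); 0, p]
  | none => !![(p : ℤ), 0; 0, 1]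

/-- The index set `I_p(N)` of the coset decomposition `Γ₀(N) diag(1,p) Γ₀(N) = ⊔_{i ∈ I_p(N)} Γ₀(N) βᵢ`:
`ℤ/pℤ`, together with `∞` (= `none`) iff `p ∤ N` (Diamond–Shurman Prop. 5.2.1). [cite: DiamondShurman2005, Prop. 5.2.1] -/
abbrev HeckeIdx (N p : ℕ) : Type :=
  {i : Option (ZMod p) // i = none → ¬p ∣ N}

/-- `det βᵢ = p`. [folklore] -/
@[simp] lemma det_heckeRep (p : ℕ) (i : Option (ZMod p)) : (heckeRep p i).det = p := by
  cases i <;> simp [heckeRep, Matrix.det_fin_two_of]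

/-- `det βᵢ ≠ 0`. [folklore] -/
lemma det_heckeRep_ne_zero {p : ℕ} (hp : p ≠ 0) (i : Option (ZMod p)) :
    (heckeRep p i).det ≠ 0 := by
  simpa using (Int.natCast_ne_zero.2 hp)

/-- Product formula `M βⱼ = (a, a j + b p; c, c j + d p)`. [folklore] -/
lemma mul_heckeRep_some (M : Matrix (Fin 2) (Fin 2) ℤ) (p : ℕ) (j : ZMod p) :
    M * heckeRep p (some j) =
      !![M 0 0, M 0 0 * j.val + M 0 1 * p; M 1 0, M 1 0 * j.val + M 1 1 * p] := by
  ext i j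
  fin_cases i <;> fin_cases j <;> simp [heckeRep, Matrix.mul_apply, Fin.sum_univ_two]

/-- Product formula `M β_∞ = (a p, b; c p, d)`. [folklore] -/
lemma mul_heckeRep_none (M : Matrix (Fin 2) (Fin 2) ℤ) (p : ℕ) :
    M * heckeRep p none = !![M 0 0 * p, M 0 1; M 1 0 * p, M 1 1] := by
  ext i j
  fin_cases i <;> fin_cases j <;> simp [heckeRep, Matrix.mul_apply, Fin.sum_univ_two]

/-- `βᵢ ∈ Δ₀ᴺ(p)` for `i ∈ I_p(N)` (`β_∞ = diag(p, 1)` needs `p ∤ N`). [folklore] -/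
lemma heckeRep_mem_delta0 {N p : ℕ} (hp : p.Prime) (i : HeckeIdx N p) :
    heckeRep p i.1 ∈ Delta0 N p := by
  obtain ⟨_ | j, hi⟩ := i
  · refine ⟨det_heckeRep p none, by simp [heckeRep], ?_⟩
    simpa [heckeRep] using Nat.isCoprime_iff_coprime.2 ((Nat.Prime.coprime_iff_not_dvd hp).2 (hi rfl))
  · exact ⟨det_heckeRep p _, by simp [heckeRep], by simp [heckeRep, isCoprime_one_left]⟩

/-- If `M' βᵢ = M` with `det M = p D` then `det M' = D`. [folklore] -/
lemma det_eq_of_mul_heckeRep_eq {p : ℕ} (hp : p ≠ 0) {D : ℤ} {i : Option (ZMod p)}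
    {M M' : Matrix (Fin 2) (Fin 2) ℤ} (hM : M.det = p * D) (h : M' * heckeRep p i = M) :
    M'.det = D := by
  have := congrArg Matrix.det h
  rw [Matrix.det_mul, det_heckeRep, hM, mul_comm] at this
  exact mul_left_cancel₀ (by exact_mod_cast hp) this

/-- The cosets `Γ₀(N) βⱼ`, `j ∈ ℤ/pℤ`: for `M ∈ Δ₀ᴺ(pD)`, `M ∈ Δ₀ᴺ(D) βⱼ` iff `p ∣ b - a j` and
`p ∣ d - c j` (Diamond–Shurman §5.2, before (5.2): "we need the upper right entry `b - ja` … to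
be `0 (mod p)`"). [cite: DiamondShurman2005, §5.2 (5.2)] -/
lemma exists_mul_heckeRep_some_iff {N p : ℕ} (hp : p ≠ 0) {D : ℤ} {M : Matrix (Fin 2) (Fin 2) ℤ}
    (hM : M ∈ Delta0 N (p * D)) (j : ZMod p) :
    (∃ M' ∈ Delta0 N D, M' * heckeRep p (some j) = M) ↔
      (p : ℤ) ∣ M 0 1 - M 0 0 * j.val ∧ (p : ℤ) ∣ M 1 1 - M 1 0 * j.val := by
  constructor
  · rintro ⟨M', -, rfl⟩
    rw [mul_heckeRep_some]
    refine ⟨⟨M' 0 1, ?_⟩, ⟨M' 1 1, ?_⟩⟩ <;> simp <;> ring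
  · rintro ⟨⟨b', hb'⟩, ⟨d', hd'⟩⟩
    have hprod : !![M 0 0, b'; M 1 0, d'] * heckeRep p (some j) = M := by
      rw [mul_heckeRep_some]
      ext i k
      fin_cases i <;> fin_cases k <;> simp <;>
        first | linear_combination -hb' | linear_combination -hd'
    exact ⟨_, ⟨det_eq_of_mul_heckeRep_eq hp hM.1 hprod, by simpa using hM.2.1,
      by simpa using hM.2.2⟩, hprod⟩

/-- The coset `Γ₀(N) β_∞`, `β_∞ = diag(p, 1)`: for `M ∈ Δ₀ᴺ(D) β_∞` one has `p ∣ a` and `p ∣ c`.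
[folklore] -/
lemma dvd_of_exists_mul_heckeRep_none {N p : ℕ} {D : ℤ} {M : Matrix (Fin 2) (Fin 2) ℤ}
    (h : ∃ M' ∈ Delta0 N D, M' * heckeRep p none = M) : (p : ℤ) ∣ M 0 0 ∧ (p : ℤ) ∣ M 1 0 := by
  obtain ⟨M', -, rfl⟩ := h
  rw [mul_heckeRep_none]
  simp

/-- Conversely, for `p ∤ N` and `M ∈ Δ₀ᴺ(pD)` with `p ∣ a`, `p ∣ c`, `M = (a/p, b; c/p, d) β_∞` with
`(a/p, b; c/p, d) ∈ Δ₀ᴺ(D)` (Diamond–Shurman §5.2 and Exercise 5.2.2: the representative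
`γ_{2,∞}` catches exactly the `γ` with `p ∣ a`). [cite: DiamondShurman2005, §5.2 (5.2) and Exercise 5.2.2] -/
lemma exists_mul_heckeRep_none {N p : ℕ} (hp : p.Prime) (hpN : ¬p ∣ N) {D : ℤ}
    {M : Matrix (Fin 2) (Fin 2) ℤ} (hM : M ∈ Delta0 N (p * D)) (ha : (p : ℤ) ∣ M 0 0)
    (hc : (p : ℤ) ∣ M 1 0) : ∃ M' ∈ Delta0 N D, M' * heckeRep p none = M := by
  obtain ⟨a', ha'⟩ := ha
  obtain ⟨c', hc'⟩ := hc
  have hprod : !![a', M 0 1; c', M 1 1] * heckeRep p none = M := by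
    rw [mul_heckeRep_none]
    ext i k
    fin_cases i <;> fin_cases k <;> simp [ha', hc', mul_comm]
  refine ⟨_, ⟨det_eq_of_mul_heckeRep_eq hp.ne_zero hM.1 hprod, ?_, ?_⟩, hprod⟩
  · -- `N ∣ c / p` since `gcd(N, p) = 1`
    have hNp : IsCoprime (N : ℤ) p :=
      Nat.isCoprime_iff_coprime.2 ((Nat.Prime.coprime_iff_not_dvd hp).2 hpN).symm
    have : (N : ℤ) ∣ c' * p := by simpa [hc', mul_comm] using hM.2.1
    simpa using hNp.dvd_of_dvd_mul_right this
  · have := hM.2.2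
    rw [ha'] at this
    simpa using this.of_mul_left_right

/-- The linear algebra behind the coset count (Diamond–Shurman §5.2, before (5.2): "If `p ∤ a`
then setting `j = b a⁻¹ (mod p)` does the job"; if `p ∣ a` the second row decides): over a
field, if `a d = b c` and `(a, c) ≠ (0, 0)` there is exactly one `j` with `a j = b` and `c j = d`.
[folklore] -/
lemma existsUnique_mul_eq_of_det_eq_zero {F : Type*} [Field F] {a b c d : F}
    (hdet : a * d - b * c = 0) (h : ¬(a = 0 ∧ c = 0)) : ∃! j : F, a * j = b ∧ c * j = d := by
  by_cases ha : a = 0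
  · have hc : c ≠ 0 := fun hc ↦ h ⟨ha, hc⟩
    have hb : b = 0 := by
      rw [ha, zero_mul, zero_sub, neg_eq_zero, mul_eq_zero] at hdet
      exact hdet.resolve_right hc
    refine ⟨d / c, ⟨by simp [ha, hb], mul_div_cancel₀ d hc⟩, fun j hj ↦ ?_⟩
    rw [eq_div_iff hc, mul_comm, hj.2]
  · refine ⟨b / a, ⟨mul_div_cancel₀ b ha, ?_⟩, fun j hj ↦ ?_⟩
    · rw [mul_div_assoc', div_eq_iff ha]
      linear_combination -hdet
    · rw [eq_div_iff ha, mul_comm, hj.1]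

/-- **Coset decomposition** `Δ₀ᴺ(pD) = ⊔_{i ∈ I_p(N)} Δ₀ᴺ(D) βᵢ` for `p` prime, `p ∤ D`
(Diamond–Shurman §5.2, (5.2), Prop. 5.2.1 and Exercises 5.2.2–5.2.4 give the case `D = 1`:
`Γ₀(N) diag(1,p) Γ₀(N) = ⊔ᵢ Γ₀(N) βᵢ`; the same elementary argument gives general `D` coprime to
`p`, needed for `T_p T_q`): every `M ∈ Δ₀ᴺ(pD)` is `M' βᵢ` with `M' ∈ Δ₀ᴺ(D)` for exactly one
`i ∈ I_p(N)`. [cite: DiamondShurman2005, §5.2 (5.2), Prop. 5.2.1, Exercises 5.2.2–5.2.4] -/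
theorem existsUnique_mem_delta0_mul_heckeRep {N p : ℕ} (hp : p.Prime) {D : ℤ}
    (hpD : ¬(p : ℤ) ∣ D) {M : Matrix (Fin 2) (Fin 2) ℤ} (hM : M ∈ Delta0 N (p * D)) :
    ∃! i : HeckeIdx N p, ∃ M' ∈ Delta0 N D, M' * heckeRep p i.1 = M := by
  haveI := Fact.mk hp
  have hp0 : (p : ℤ) ≠ 0 := by exact_mod_cast hp.ne_zero
  have hdvd : ∀ x : ℤ, (p : ℤ) ∣ x ↔ (x : ZMod p) = 0 := fun x ↦
    (ZMod.intCast_zmod_eq_zero_iff_dvd x p).symm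
  -- the determinant vanishes mod `p`
  have hdet : (M 0 0 : ZMod p) * M 1 1 - M 0 1 * M 1 0 = 0 := by
    have h := congrArg (Int.cast : ℤ → ZMod p) hM.1
    rw [Matrix.det_fin_two] at h
    push_cast at h
    rw [h, ZMod.natCast_self, zero_mul]
  -- the `some j` cosets, read in `ℤ/pℤ`
  have hsome : ∀ j : ZMod p, (∃ M' ∈ Delta0 N D, M' * heckeRep p (some j) = M) ↔
      (M 0 0 : ZMod p) * j = M 0 1 ∧ (M 1 0 : ZMod p) * j = M 1 1 := by
    intro j
    rw [exists_mul_heckeRep_some_iff hp.ne_zero hM, hdvd, hdvd]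
    push_cast
    rw [ZMod.natCast_zmod_val, sub_eq_zero, sub_eq_zero, eq_comm, eq_comm (a := (M 1 1 : ZMod p))]
  by_cases hac : (p : ℤ) ∣ M 0 0 ∧ (p : ℤ) ∣ M 1 0
  · -- Case `p ∣ a`, `p ∣ c`: the coset of `β_∞`; here `p ∤ N` since `gcd(a, N) = 1`
    have hpN : ¬p ∣ N := by
      rintro hpN
      obtain ⟨u, v, huv⟩ := hM.2.2
      have : (p : ℤ) ∣ 1 := huv ▸ dvd_add (dvd_mul_of_dvd_right hac.1 u)
        (dvd_mul_of_dvd_right (Int.natCast_dvd_natCast.2 hpN) v)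
      exact hp.ne_one (Nat.dvd_one.1 (Int.natCast_dvd_natCast.1 (by simpa using this)))
    refine ⟨⟨none, fun _ ↦ hpN⟩, exists_mul_heckeRep_none hp hpN hM hac.1 hac.2, ?_⟩
    rintro ⟨_ | j, hi⟩ h
    · rfl
    · -- a `βⱼ`-coset would force `p ∣ b`, `p ∣ d`, hence `p² ∣ det M = pD`
      exfalso
      obtain ⟨h1, h2⟩ := (exists_mul_heckeRep_some_iff hp.ne_zero hM j).1 h
      have hb : (p : ℤ) ∣ M 0 1 := by
        simpa using dvd_add h1 (dvd_mul_of_dvd_left hac.1 (j.val : ℤ))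
      have hd : (p : ℤ) ∣ M 1 1 := by
        simpa using dvd_add h2 (dvd_mul_of_dvd_left hac.2 (j.val : ℤ))
      have : (p : ℤ) * p ∣ p * D := by
        rw [← hM.1, Matrix.det_fin_two]
        exact dvd_sub (mul_dvd_mul hac.1 hd) (mul_dvd_mul hb hac.2)
      exact hpD ((mul_dvd_mul_iff_left hp0).1 this)
  · -- Case `(a, c) ≢ (0, 0) mod p`: exactly one `βⱼ`-coset
    have hac' : ¬((M 0 0 : ZMod p) = 0 ∧ (M 1 0 : ZMod p) = 0) := by rwa [← hdvd, ← hdvd]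
    obtain ⟨j, hj, hju⟩ := existsUnique_mul_eq_of_det_eq_zero hdet hac'
    refine ⟨⟨some j, by simp⟩, (hsome j).2 hj, ?_⟩
    rintro ⟨_ | j', hi⟩ h
    · exact absurd (dvd_of_exists_mul_heckeRep_none h) hac
    · have := hju j' ((hsome j').1 h)
      subst this
      rfl


/-! ### Integer matrices in `GL(2, ℝ)` -/

/-- An integer matrix of nonzero determinant regarded as an element of `GL(2, ℝ)` (entrywise cast;
junk value `1` when the determinant vanishes). [folklore] -/
def intGL (M : Matrix (Fin 2) (Fin 2) ℤ) : GL (Fin 2) ℝ :=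
  if h : ((Int.castRingHom ℝ).mapMatrix M).det ≠ 0 then
    Matrix.GeneralLinearGroup.mkOfDetNeZero _ h
  else 1

/-- The underlying real matrix of `intGL M` is the entrywise cast of `M`. [folklore] -/
lemma coe_intGL {M : Matrix (Fin 2) (Fin 2) ℤ} (hM : M.det ≠ 0) :
    ((intGL M : GL (Fin 2) ℝ) : Matrix (Fin 2) (Fin 2) ℝ) = M.map (Int.castRingHom ℝ) := by
  have h : ((Int.castRingHom ℝ).mapMatrix M).det ≠ 0 := by
    rw [← RingHom.map_det, eq_intCast]
    exact_mod_cast hM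
  rw [intGL, dif_pos h]
  rfl

/-- Entries of `intGL M`. [folklore] -/
@[simp] lemma intGL_apply {M : Matrix (Fin 2) (Fin 2) ℤ} (hM : M.det ≠ 0) (i j : Fin 2) :
    (intGL M : GL (Fin 2) ℝ) i j = (M i j : ℝ) := by
  rw [coe_intGL hM]
  simp

/-- `intGL` is injective on matrices of nonzero determinant. [folklore] -/
lemma intGL_inj {M M' : Matrix (Fin 2) (Fin 2) ℤ} (hM : M.det ≠ 0) (hM' : M'.det ≠ 0)
    (h : intGL M = intGL M') : M = M' := by
  have := congrArg (fun g : GL (Fin 2) ℝ ↦ (g : Matrix (Fin 2) (Fin 2) ℝ)) h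
  simp only [coe_intGL hM, coe_intGL hM'] at this
  exact Matrix.map_injective (Int.castRingHom ℝ).injective_int this

/-- `intGL` is multiplicative on matrices of nonzero determinant. [folklore] -/
lemma intGL_mul {M M' : Matrix (Fin 2) (Fin 2) ℤ} (hM : M.det ≠ 0) (hM' : M'.det ≠ 0) :
    intGL (M * M') = intGL M * intGL M' := by
  refine Units.ext ?_
  rw [Units.val_mul, coe_intGL hM, coe_intGL hM', ← Matrix.map_mul,
    coe_intGL (by rw [Matrix.det_mul]; exact mul_ne_zero hM hM')]

/-- Mathlib's `mapGL ℝ γ` for `γ ∈ SL(2, ℤ)` is `intGL γ`. [folklore] -/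
lemma mapGL_eq_intGL (γ : SL(2, ℤ)) : (mapGL ℝ γ : GL (Fin 2) ℝ) = intGL γ := by
  ext i j
  simp [mapGL]

/-- **Transfer to integer matrices.** For integer matrices `M, B` of nonzero determinant,
`M B⁻¹ ∈ Γ₀(N)` in `GL(2, ℝ)` iff `M = γ B` for some `γ ∈ Γ₀(N)`. [folklore] -/
lemma intGL_mul_inv_mem_gamma0_iff {N : ℕ} {M B : Matrix (Fin 2) (Fin 2) ℤ} (hM : M.det ≠ 0)
    (hB : B.det ≠ 0) :
    intGL M * (intGL B)⁻¹ ∈ (Gamma0 N : Subgroup (GL (Fin 2) ℝ)) ↔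
      ∃ γ : SL(2, ℤ), γ ∈ Gamma0 N ∧ (γ : Matrix (Fin 2) (Fin 2) ℤ) * B = M := by
  constructor
  · rintro ⟨γ, hγ, h⟩
    refine ⟨γ, hγ, intGL_inj (by simp [Matrix.det_mul, hB]) hM ?_⟩
    rw [intGL_mul (by simp) hB, ← mapGL_eq_intGL, h, inv_mul_cancel_right]
  · rintro ⟨γ, hγ, h⟩
    refine ⟨γ, hγ, ?_⟩
    rw [eq_mul_inv_iff_mul_eq, mapGL_eq_intGL, ← intGL_mul (by simp) hB, h]

/-! ### Comparison with `tpG`, `tpB`, `tpD` of `HeckeOperatorsProofs` -/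

/-- The matrix `tpG p = diag(1, p)` of `HeckeOperatorsProofs` (the image in `GL(2, ℝ)` of the
matrix `diagGL 1 p` defining `heckeT`) is `intGL diag(1, p)`. [folklore] -/
lemma tpG_eq_intGL (p : ℕ) [NeZero p] : tpG p = intGL !![1, 0; 0, (p : ℤ)] := by
  have hd : (!![1, 0; 0, (p : ℤ)]).det ≠ 0 := by simp [Matrix.det_fin_two_of, NeZero.ne p]
  ext i j
  rw [intGL_apply hd, val_tpG]
  fin_cases i <;> fin_cases j <;> simp

/-- `intGL βⱼ` is the matrix `tpB p j = (1 j; 0 p)` of `HeckeOperatorsProofs` (Diamond–Shurman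
(5.2)), for the lift `0 ≤ j < p`. [folklore] -/
lemma intGL_heckeRep_some (p : ℕ) [NeZero p] (j : ZMod p) :
    intGL (heckeRep p (some j)) = tpB p (j.val : ℤ) := by
  ext i k
  rw [intGL_apply (det_heckeRep_ne_zero (NeZero.ne p) _), val_tpB]
  fin_cases i <;> fin_cases k <;> simp [heckeRep]

/-- `intGL β_∞` is the matrix `tpD p = diag(p, 1)` of `HeckeOperatorsProofs`. [folklore] -/
lemma intGL_heckeRep_none (p : ℕ) [NeZero p] : intGL (heckeRep p none) = tpD p := by
  ext i k
  rw [intGL_apply (det_heckeRep_ne_zero (NeZero.ne p) _), val_tpD]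
  fin_cases i <;> fin_cases k <;> simp [heckeRep]

/-- A sum over the index set `I_p(N)` is the sum over `ℤ/pℤ` plus, when `p ∤ N`, the term at `∞`.
[folklore] -/
lemma sum_heckeIdx {M : Type*} [AddCommMonoid M] (N p : ℕ) [NeZero p]
    (g : Option (ZMod p) → M) :
    ∑ i : HeckeIdx N p, g i.1 = ∑ j : ZMod p, g (some j) + if p ∣ N then 0 else g none := by
  classical
  rw [← Finset.sum_subtype (Finset.univ.filter fun i : Option (ZMod p) ↦ i = none → ¬p ∣ N)
    (fun i ↦ by simp) g, Finset.sum_filter, Fintype.sum_option, add_comm]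
  simp only [reduceCtorEq, false_implies, if_true, forall_const, ite_not]

/-- Re-indexing a sum over `ℤ/pℤ` by the lifts `0 ≤ j < p` (`Fin p`). [folklore] -/
lemma sum_zmod_val_eq_sum_fin {M : Type*} [AddCommMonoid M] (p : ℕ) [NeZero p] (F : ℕ → M) :
    ∑ j : ZMod p, F j.val = ∑ j : Fin p, F j := by
  obtain ⟨n, rfl⟩ := Nat.exists_eq_succ_of_ne_zero (NeZero.ne p)
  rfl

section Gamma0

variable (N : ℕ) [NeZero N] (k : ℤ)

/-- **`T_p` on `S_k(Γ₀(N))` as a finite sum** over the index set `I_p(N)` (`HeckeIdx N p`):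
for `p` prime, `T_p f = ∑_{i ∈ I_p(N)} f ∣[k] βᵢ`, i.e.
`T_p f = ∑_{j mod p} f ∣[k] (1 j; 0 p) + 𝟙_{p ∤ N} · f ∣[k] diag(p, 1)` (Diamond–Shurman Prop. 5.2.1
with Exercise 5.2.4). This is the tree's `coe_heckeT_gamma0_eq_sum` (`HeckeOperatorsProofs`,
Prop. 5.2.1 for `Γ₀(N)`) rewritten through `intGL_heckeRep_some`, `intGL_heckeRep_none` and
`sum_heckeIdx`; it is not re-derived. [cite: DiamondShurman2005, Prop. 5.2.1 and Exercise 5.2.4] -/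
theorem coe_heckeT_gamma0 (p : ℕ) [NeZero p] (hp : p.Prime) (f : CuspForm (Gamma0 N) k) :
    (⇑(heckeT (Gamma0 N) k p f) : ℍ → ℂ) =
      ∑ i : HeckeIdx N p, ⇑f ∣[k] intGL (heckeRep p i.1) := by
  rw [coe_heckeT_gamma0_eq_sum N k p hp f, sum_heckeIdx N p fun i ↦ ⇑f ∣[k] intGL (heckeRep p i)]
  simp only [intGL_heckeRep_some, intGL_heckeRep_none]
  rw [← sum_zmod_val_eq_sum_fin p fun j ↦ ⇑f ∣[k] tpB p (j : ℤ)]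

/-- **`T_p T_q` as a double sum**: `(T_p T_q) f = ∑_{i ∈ I_p(N)} ∑_{j ∈ I_q(N)} f ∣[k] (β^q_j β^p_i)`
on `S_k(Γ₀(N))` (from `coe_heckeT_gamma0` twice and `f ∣[k] (g h) = (f ∣[k] g) ∣[k] h`;
Diamond–Shurman §5.2, proof of Prop. 5.2.4). [cite: DiamondShurman2005, §5.2 Prop. 5.2.1] -/
theorem coe_heckeT_mul_heckeT_gamma0 (p q : ℕ) [NeZero p] [NeZero q] (hp : p.Prime)
    (hq : q.Prime) (f : CuspForm (Gamma0 N) k) :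
    (⇑((heckeT (Gamma0 N) k p * heckeT (Gamma0 N) k q) f) : ℍ → ℂ) =
      ∑ i : HeckeIdx N p, ∑ j : HeckeIdx N q,
        ⇑f ∣[k] intGL (heckeRep q j.1 * heckeRep p i.1) := by
  rw [Module.End.mul_apply, coe_heckeT_gamma0 N k p hp]
  refine Finset.sum_congr rfl fun i _ ↦ ?_
  rw [coe_heckeT_gamma0 N k q hq, SlashAction.sum_slash]
  refine Finset.sum_congr rfl fun j _ ↦ ?_
  rw [intGL_mul (det_heckeRep_ne_zero hq.ne_zero _) (det_heckeRep_ne_zero hp.ne_zero _),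
    SlashAction.slash_mul]

omit [NeZero N] in
/-- The products `β^q_j β^p_i` lie in `Δ₀ᴺ(pq)`. [folklore] -/
lemma intGL_heckeRep_mul_mem {p q : ℕ} (hp : p.Prime) (hq : q.Prime) (i : HeckeIdx N p)
    (j : HeckeIdx N q) :
    intGL (heckeRep q j.1 * heckeRep p i.1) ∈ intGL '' Delta0 N ((p : ℤ) * q) := by
  refine ⟨_, ?_, rfl⟩
  simpa [mul_comm] using mul_mem_delta0 (heckeRep_mem_delta0 hq j) (heckeRep_mem_delta0 hp i)

omit [NeZero N] in
/-- **The products `β^q_j β^p_i` (`i ∈ I_p(N)`, `j ∈ I_q(N)`) form an exact transversal of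
`Γ₀(N) \ Δ₀ᴺ(pq)`** for distinct primes `p, q`: every `M ∈ Δ₀ᴺ(pq)` is `γ β^q_j β^p_i` with
`γ ∈ Γ₀(N)` for exactly one pair `(i, j)` (`existsUnique_mem_delta0_mul_heckeRep` for `(p, D = q)`
and `(q, D = 1)`; this is the coset-level content of Diamond–Shurman Prop. 5.2.4(c)).
Stated in `GL(2, ℝ)`. [cite: DiamondShurman2005, §5.2 Prop. 5.2.1 and Prop. 5.2.4] -/
theorem existsUnique_heckeRep_mul {p q : ℕ} (hp : p.Prime) (hq : q.Prime) (hpq : p ≠ q)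
    {x : GL (Fin 2) ℝ} (hx : x ∈ intGL '' Delta0 N ((p : ℤ) * q)) :
    ∃! ij : HeckeIdx N p × HeckeIdx N q,
      x * (intGL (heckeRep q ij.2.1 * heckeRep p ij.1.1))⁻¹ ∈
        (Gamma0 N : Subgroup (GL (Fin 2) ℝ)) := by
  obtain ⟨M, hM, rfl⟩ := hx
  have hp0 : (p : ℤ) ≠ 0 := by exact_mod_cast hp.ne_zero
  have hq0 : (q : ℤ) ≠ 0 := by exact_mod_cast hq.ne_zero
  have hMdet : M.det ≠ 0 := by
    rw [hM.1]
    exact mul_ne_zero hp0 hq0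
  have key : ∀ ij : HeckeIdx N p × HeckeIdx N q,
      intGL M * (intGL (heckeRep q ij.2.1 * heckeRep p ij.1.1))⁻¹ ∈
          (Gamma0 N : Subgroup (GL (Fin 2) ℝ)) ↔
        ∃ M' ∈ Delta0 N 1, M' * (heckeRep q ij.2.1 * heckeRep p ij.1.1) = M := fun ij ↦ by
    rw [intGL_mul_inv_mem_gamma0_iff hMdet (by simp [Matrix.det_mul, hp.ne_zero, hq.ne_zero]),
      exists_mem_delta0_one_iff]
  rw [existsUnique_congr key]
  have hqD : ¬(p : ℤ) ∣ q := by
    exact_mod_cast (Nat.prime_dvd_prime_iff_eq hp hq).not.2 hpq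
  obtain ⟨i, ⟨M₁, hM₁, hi⟩, hiu⟩ := existsUnique_mem_delta0_mul_heckeRep hp hqD hM
  obtain ⟨j, ⟨M₂, hM₂, hj⟩, hju⟩ := existsUnique_mem_delta0_mul_heckeRep hq (D := 1)
    (by exact_mod_cast hq.not_dvd_one) (M := M₁) (by simpa using hM₁)
  refine ⟨(i, j), ⟨M₂, hM₂, by rw [← Matrix.mul_assoc, hj, hi]⟩, ?_⟩
  rintro ⟨i', j'⟩ ⟨M₂', hM₂', h'⟩
  have hi' : i' = i := hiu i' ⟨M₂' * heckeRep q j'.1,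
    by simpa using mul_mem_delta0 hM₂' (heckeRep_mem_delta0 hq j'),
    by rw [Matrix.mul_assoc]; exact h'⟩
  subst hi'
  have h2 : M₂' * heckeRep q j'.1 = M₁ :=
    matrix_mul_right_cancel_of_det_ne_zero (det_heckeRep_ne_zero hp.ne_zero i'.1)
      (by rw [Matrix.mul_assoc, h', hi])
  have hj' : j' = j := hju j' ⟨M₂', hM₂', h2⟩
  subst hj'
  rfl

/-- **`T_p T_q = T_q T_p` on `S_k(Γ₀(N))`** for primes `p, q` (Diamond–Shurman Prop. 5.2.4(c),
stated for `M_k(Γ₁(N)) ⊇ S_k(Γ₀(N)) = S_k(N, 𝟙)`); this is the case `p, q` prime of the fact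
`heckeT_comm_gamma0` of `HeckeOperators` (which quantifies over all nonzero `p, q`). Proof: for `p ≠ q`, both `(T_p T_q) f` and
`(T_q T_p) f` are `∑ f ∣[k] α` over an exact transversal `α` of `Γ₀(N) \ Δ₀ᴺ(pq)`
(`coe_heckeT_mul_heckeT_gamma0`, `existsUnique_heckeRep_mul`), hence equal by
`sum_slash_eq_sum_slash_of_transversal`. [cite: DiamondShurman2005, Prop. 5.2.4] -/
theorem heckeT_comm_gamma0_of_prime (p q : ℕ) [NeZero p] [NeZero q] (hp : p.Prime)
    (hq : q.Prime) :
    heckeT (Gamma0 N) k p * heckeT (Gamma0 N) k q =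
      heckeT (Gamma0 N) k q * heckeT (Gamma0 N) k p := by
  rcases eq_or_ne p q with rfl | hpq
  · rfl
  refine LinearMap.ext fun f ↦ DFunLike.ext' ?_
  rw [coe_heckeT_mul_heckeT_gamma0 N k p q hp hq, coe_heckeT_mul_heckeT_gamma0 N k q p hq hp,
    ← Fintype.sum_prod_type'
      (f := fun (i : HeckeIdx N p) (j : HeckeIdx N q) ↦
        ⇑f ∣[k] intGL (heckeRep q j.1 * heckeRep p i.1)),
    ← Fintype.sum_prod_type'
      (f := fun (j : HeckeIdx N q) (i : HeckeIdx N p) ↦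
        ⇑f ∣[k] intGL (heckeRep p i.1 * heckeRep q j.1))]
  have hf : ∀ γ ∈ (Gamma0 N : Subgroup (GL (Fin 2) ℝ)), ⇑f ∣[k] γ = ⇑f := fun γ hγ ↦
    SlashInvariantFormClass.slash_action_eq f γ hγ
  refine sum_slash_eq_sum_slash_of_transversal hf (intGL '' Delta0 N ((p : ℤ) * q))
    (fun ij ↦ intGL_heckeRep_mul_mem N hp hq ij.1 ij.2)
    (fun x hx ↦ existsUnique_heckeRep_mul N hp hq hpq hx) (fun ji ↦ ?_) (fun x hx ↦ ?_)
  · rw [mul_comm]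
    exact intGL_heckeRep_mul_mem N hq hp ji.1 ji.2
  · rw [mul_comm] at hx
    exact existsUnique_heckeRep_mul N hq hp hpq.symm hx

/-- Discharge of `heckeAlgebra_commutative_gamma0`: **the Hecke algebra of `S_k(Γ₀(N))`** — the
`ℂ`-subalgebra of `End(S_k(Γ₀(N)))` generated by the `T_p`, `p` prime (`heckeAlgebra`) — **is
commutative** (Diamond–Shurman, *A first course in modular forms*, Prop. 5.2.4(c):
`T_p T_q = T_q T_p`, and §5.3 after (5.11): "the `T_n` all commute by Proposition 5.2.4"). Proof: the
generators commute pairwise (`heckeT_comm_gamma0_of_prime`), and an algebra generated by pairwise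
commuting elements is commutative (`Algebra.commute_of_mem_adjoin_of_forall_mem_commute`). [cite: DiamondShurman2005, Prop. 5.2.4 and §5.3] -/
theorem heckeAlgebra_commutative_gamma0_holds : heckeAlgebra_commutative_gamma0 N k := by
  intro S T hS hT
  refine (Algebra.commute_of_mem_adjoin_of_forall_mem_commute hT fun b hb ↦ ?_).eq
  refine (Algebra.commute_of_mem_adjoin_of_forall_mem_commute hS fun a ha ↦ ?_).symm
  obtain ⟨p, rfl⟩ := ha
  obtain ⟨q, rfl⟩ := hb
  haveI : NeZero (p : ℕ) := ⟨p.2.ne_zero⟩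
  haveI : NeZero (q : ℕ) := ⟨q.2.ne_zero⟩
  exact heckeT_comm_gamma0_of_prime N k q p q.2 p.2

end Gamma0

end Literature.NumberTheory.EllipticCurves.ModularForms

end
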